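import Literature.NumberTheory.Rogawski1990.ArchCharactersRealCase           -- ★ p827732 (A-p06 (g23)): (γ) `archRealCase_of_package`; ★ A8 `archRealReduction` (p826869) via its imports
import Literature.NumberTheory.Rogawski1990.ArchTestKcPackage                -- ★ p827885 (F0P3b-p01 (g0)): (β) `archTestKc_package`
import Literature.NumberTheory.Rogawski1990.ArchCharactersLinIndep           -- ★ p825905 (typ-T1a): the HEAD text `ArchCharactersLinIndep` (= #85 at `S = ∅`)
import Literature.NumberTheory.Automorphic.GKInfinitesimallyUnitaryConverse  -- ★ (A-p14 (g22)): (α) `sixClauses_holds`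
import HarnessLib

/-!
# CLOSER of `stub_archAssembly` — the archimedean factor of #85 (L2-SA) assembled from its three printed letters (crux H413, T1a arch line)

Cell `hodgecm-mathlib`, F0∕P3 «U3-mult», crux H413 (`stmt-HodgeConjecture-24833`); the REGISTERED nested line
`Cruxes/H413/Lines/F0_T1a_ArchCharactersLinIndep.lean` (commit b8fa30127498, desk F0P3b-plan (g8)), whose last open payable stub is
`stub_archAssembly : A1 → A5 → A6 → A7′ → ArchRealCase` (sub-goals (α) six-clause bridge, (β) `ArchTestKcPackage`, (γ) instantiation).  Seat F0P3b-p01 (g0),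
LEAD of that stub (director s587 ROLLING MINT T1a).  PROOF LANE: theorems only; no `def`, no instance, no notation, no `sorry`; imports are BUILT ★ Literature
modules only (desk note 15:56:24Z: no `Cruxes/…/Lines` import, so that BOTH registered lines T1a (ED. 6) and T1b (ED. 5) fold from this module BY NAME).

WHAT IS PROVED (all three sub-goals being ★: (α) `Literature.NumberTheory.Automorphic.sixClauses_holds` (A-p14 (g22)), (β)
`Literature.NumberTheory.Rogawski1990.archTestKc_package` (p827885), (γ) `Literature.NumberTheory.Rogawski1990.archRealCase_of_package` (p827732, A-p06 (g23))):
* `archAssembly_holds : WeightedHilbertSchmidtVanishing → ‹A5 ∀-text› → HasUnitaryGlobalizationOfInfUnitary → UnitaryGlobalizationIrreducible → ‹ArchRealCase›` —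
  the TYPE of the registered `stub_archAssembly` TOKEN FOR TOKEN (its four antecedents are the Lines file's closed∕letter stubs A1, A5, A6, A7′; the
  conclusion is the BODY of the Lines `def ArchRealCase`), so that T1a ED. 6 is the one-liner `stub_archAssembly := F0T1aArchAssembly.archAssembly_holds`;
  proof = `archRealCase_of_package hTC hGE hIR sixClauses_holds archTestKc_package` (the A1 binder is idle: (γ) instantiates the universe-polymorphic form of A1,
  ★ `forall_weight_eq_zero_of_tsum_weighted_hilbertSchmidt_eq_zero`, directly — typ-T1a «=» 15:29:22Z).
* `archCharactersLinIndep_of_letters (hTC) (hGE) (hIR) (L ι H T hT νinf) : Rogawski1990.ArchCharactersLinIndep L ι H T hT νinf` — THE PARAMETRISED LETTER ITSELF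
  from the three printed letters (desk 15:56:24Z shape (a)): the Lines file's kernel-checked composition re-run against ★ A8 `archRealReduction` (real and imaginary
  parts keep the support clause) and `archAssembly_holds`; `Complex.ext`.  T1b ED. 5 may fold `stub_archFactor` from it BY NAME.
* `archCharactersLinIndep_closed_of_letters` — the same in the ∀-closed shape of the Lines head `ArchCharactersLinIndepClosed`.

HONEST LABEL: the three LETTERS A5 [Knapp1986 Thm. 10.2] (`ArchIntegratedOperatorTraceClass`), A6 [KnappVogan1995 Thm. 0.6 (a)] (`HasUnitaryGlobalizationOfInfUnitary`),
A7′ [KnappVogan1995 Thm. 0.4] (`UnitaryGlobalizationIrreducible`) stay HYPOTHESES — nothing printed is discharged here; HC_CM is proved only modulo the 2 remaining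
named inputs (hLiu418, h413) until rung 0 closes.

## References
* J.-P. Labesse, R. P. Langlands, *L-indistinguishability for SL(2)*, Canad. J. Math. 31 (1979), Lemma 6.1 pp. 768–769 [LabesseLanglands1979].
* J. D. Rogawski, *Automorphic Representations of Unitary Groups in Three Variables* (1990), Prop. 13.8.1 p. 212 [Rogawski1990].
* H. Jacquet, R. P. Langlands, *Automorphic Forms on GL(2)*, LNM 114 (1970), Lemma 16.1.1 (proof) p. 498 [JacquetLanglands1970].
-/

set_option autoImplicit false
set_option linter.dupNamespace false

noncomputable section

open NumberField IsDedekindDomain MeasureTheory Filter Topology CompactlySupported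
open Literature.NumberTheory.Rogawski1990 Literature.NumberTheory.Automorphic Literature.NumberTheory.Automorphic.UnitaryGroup
open Literature.RepresentationTheory Literature.RepresentationTheory.KonnoKonno2007 Literature.RepresentationTheory.KonnoKonno2007.RealDualPair
-- `Classical`: `NormedCommRing (mixedSpace L)` (place subtypes are `Fintype` classically), as in ★ `SemilocalCharactersLinIndep`; `ComplexOrder`: `Matrix.PosDef` over `ℂ`
-- — the scopes under which the Lines texts `ArchRealCase` ∕ `ArchTestKcPackage` are elaborated (token-for-token match).
open scoped Matrix Classical ComplexOrder InnerProductSpace ENNReal NNReal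

namespace Summit.HodgeConjecture.HodgeConjecture.Cruxes.H413.F0T1aArchAssembly

/-! ## §1 The registered stub `stub_archAssembly`, closed -/

/-- **`stub_archAssembly` CLOSED — Labesse–Langlands' Lemma 6.1 INSTANTIATED**: the abstract node A1 (`WeightedHilbertSchmidtVanishing`, idle binder — (γ) uses its
universe-polymorphic form directly), the trace-class letter A5, the globalization letter A6 and the irreducibility letter A7′ imply `ArchRealCase` (the head for REAL
coefficient families with the ORIGINAL support clause of #85), by ★ (γ) `archRealCase_of_package` fed with ★ (α) `sixClauses_holds` (the six-clause bridge
`IsInfUnitaryAlongP ⇒ Liu2021.LemD2.IsInfUnitary` for `U(2,1)`) and ★ (β) `archTestKc_package` (the `ArchTestKc` `*`-algebra, bi-`K_c`-averages, Dirac sequence).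
The statement is the TYPE of `stub_archAssembly` of `Cruxes/H413/Lines/F0_T1a_ArchCharactersLinIndep.lean` (b8fa30127498 :210–:216) token for token.
[cite: LabesseLanglands1979, Lemma 6.1 pp. 768–769] [cite: Rogawski1990, Prop. 13.8.1 p. 212] [cite: JacquetLanglands1970, Lemma 16.1.1 (proof) p. 498] -/
theorem archAssembly_holds :
    WeightedHilbertSchmidtVanishing →
    (∀ (L : Type) [Field L] [NumberField L] [IsCMField L] (ι : L →+* ℂ) (H : Matrix (Fin 3) (Fin 3) L) (T : GL (Fin 3) ℂ)
      (hT : (T : Matrix (Fin 3) (Fin 3) ℂ)ᴴ * H.map ι * (T : Matrix (Fin 3) (Fin 3) ℂ) = Literature.Geometry.ComplexHyperbolic.BallModel.J)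
      (νinf : @Measure (UnitaryGroup.arch (↥(maximalRealSubfield L)) L (IsCMField.complexConj L) 3 H) (borel _)),
      ArchIntegratedOperatorTraceClass L ι H T hT νinf) →
    HasUnitaryGlobalizationOfInfUnitary → UnitaryGlobalizationIrreducible →
    ∀ (L : Type) [Field L] [NumberField L] [IsCMField L] (ι : L →+* ℂ) (H : Matrix (Fin 3) (Fin 3) L) (T : GL (Fin 3) ℂ)
      (hT : (T : Matrix (Fin 3) (Fin 3) ℂ)ᴴ * H.map ι * (T : Matrix (Fin 3) (Fin 3) ℂ) = Literature.Geometry.ComplexHyperbolic.BallModel.J)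
      (νinf : @Measure (UnitaryGroup.arch (↥(maximalRealSubfield L)) L (IsCMField.complexConj L) 3 H) (borel _)),
      (∀ τ' : L →+* ℂ, InfinitePlace.mk τ' ≠ InfinitePlace.mk ι → (H.map τ').PosDef) →
      @Measure.IsHaarMeasure _ _ _ (borel _) νinf →
      ∀ (b : GKIrrClass (uFormGroup (Fin 2) (Fin 1)) → ℝ),
        (∀ y, b y ≠ 0 →
          ∃ r : GKIrrep (uFormGroup (Fin 2) (Fin 1)), GKIrrClass.mk r = y ∧ IsAdmissibleGK r.ρK ∧ r.IsInfUnitaryAlongP) →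
        (∀ φ : UnitaryGroup.arch (↥(maximalRealSubfield L)) L (IsCMField.complexConj L) 3 H → ℂ,
            ArchTestKc L ι H T hT φ → Summable fun y => (b y : ℂ) * archTr₀ L ι H T hT νinf y φ) →
        (∀ φ : UnitaryGroup.arch (↥(maximalRealSubfield L)) L (IsCMField.complexConj L) 3 H → ℂ,
            ArchTestKc L ι H T hT φ → ∑' y, (b y : ℂ) * archTr₀ L ι H T hT νinf y φ = 0) →
        ∀ y, b y = 0 :=
  fun _hW hTC hGE hIR => archRealCase_of_package hTC hGE hIR sixClauses_holds archTestKc_package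

/-! ## §2 The parametrised letter `ArchCharactersLinIndep L ι H T hT νinf` from the three printed letters -/

/-- **THE ARCHIMEDEAN FACTOR OF #85 FROM ITS THREE PRINTED LETTERS** — for every CM frame `(L, ι, H, T)` and Borel measure `νinf` on `G′_∞`: the trace-class letter A5
[Knapp1986 Thm. 10.2], the globalization letter A6 [KnappVogan1995 Thm. 0.6 (a)] and the irreducibility letter A7′ [KnappVogan1995 Thm. 0.4] imply ★
`Rogawski1990.ArchCharactersLinIndep L ι H T hT νinf` [Rogawski1990 Prop. 13.8.1 at `S = ∅`]: split a complex coefficient family `a = Re a + i Im a` by ★ A8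
`archRealReduction` (both parts keep the support clause and the summable-with-sum-zero hypotheses, `ArchTestKc` being `*`-closed and `νinf` inversion invariant),
kill both real families by `archAssembly_holds`, `Complex.ext` — the kernel-checked composition `archCharactersLinIndep_of_stubs` of the Lines file, re-run here
against BUILT modules (desk 15:56:24Z (a)).  This is the TYPE of T1b's `stub_archFactor` after its three letter binders. [cite: Rogawski1990, Prop. 13.8.1 p. 212]
[cite: LabesseLanglands1979, Lemma 6.1 pp. 768–769] -/
theorem archCharactersLinIndep_of_letters
    (hTC : ∀ (L : Type) [Field L] [NumberField L] [IsCMField L] (ι : L →+* ℂ) (H : Matrix (Fin 3) (Fin 3) L) (T : GL (Fin 3) ℂ)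
      (hT : (T : Matrix (Fin 3) (Fin 3) ℂ)ᴴ * H.map ι * (T : Matrix (Fin 3) (Fin 3) ℂ) = Literature.Geometry.ComplexHyperbolic.BallModel.J)
      (νinf : @Measure (UnitaryGroup.arch (↥(maximalRealSubfield L)) L (IsCMField.complexConj L) 3 H) (borel _)),
      ArchIntegratedOperatorTraceClass L ι H T hT νinf)
    (hGE : HasUnitaryGlobalizationOfInfUnitary) (hIR : UnitaryGlobalizationIrreducible)
    (L : Type) [Field L] [NumberField L] [IsCMField L] (ι : L →+* ℂ) (H : Matrix (Fin 3) (Fin 3) L) (T : GL (Fin 3) ℂ)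
    (hT : (T : Matrix (Fin 3) (Fin 3) ℂ)ᴴ * H.map ι * (T : Matrix (Fin 3) (Fin 3) ℂ) = Literature.Geometry.ComplexHyperbolic.BallModel.J)
    (νinf : @Measure (UnitaryGroup.arch (↥(maximalRealSubfield L)) L (IsCMField.complexConj L) 3 H) (borel _)) :
    ArchCharactersLinIndep L ι H T hT νinf := by
  rw [archCharactersLinIndep_iff]
  intro hdef hν a hsupp hsum hzero y
  have hRC := archAssembly_holds weightedHilbertSchmidtVanishing_holds hTC hGE hIR
  -- real and imaginary parts (★ A8)
  obtain ⟨⟨hsre, hzre⟩, hsim, hzim⟩ := archRealReduction L ι H T hT νinf hν a hsum hzero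
  have hre : (a y).re = 0 :=
    hRC L ι H T hT νinf hdef hν (fun y => (a y).re)
      (fun y hy => hsupp y fun h => hy (by rw [h, Complex.zero_re])) hsre hzre y
  have him : (a y).im = 0 :=
    hRC L ι H T hT νinf hdef hν (fun y => (a y).im)
      (fun y hy => hsupp y fun h => hy (by rw [h, Complex.zero_im])) hsim hzim y
  exact Complex.ext hre him

/-- **The ∀-closed shape** (the Lines head `ArchCharactersLinIndepClosed`, from the three letters): ★ `ArchCharactersLinIndep L ι H T hT νinf` at every frame.
[cite: Rogawski1990, Prop. 13.8.1 p. 212] [cite: LabesseLanglands1979, Lemma 6.1 pp. 768–769] -/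
theorem archCharactersLinIndep_closed_of_letters
    (hTC : ∀ (L : Type) [Field L] [NumberField L] [IsCMField L] (ι : L →+* ℂ) (H : Matrix (Fin 3) (Fin 3) L) (T : GL (Fin 3) ℂ)
      (hT : (T : Matrix (Fin 3) (Fin 3) ℂ)ᴴ * H.map ι * (T : Matrix (Fin 3) (Fin 3) ℂ) = Literature.Geometry.ComplexHyperbolic.BallModel.J)
      (νinf : @Measure (UnitaryGroup.arch (↥(maximalRealSubfield L)) L (IsCMField.complexConj L) 3 H) (borel _)),
      ArchIntegratedOperatorTraceClass L ι H T hT νinf)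
    (hGE : HasUnitaryGlobalizationOfInfUnitary) (hIR : UnitaryGlobalizationIrreducible) :
    ∀ (L : Type) [Field L] [NumberField L] [IsCMField L] (ι : L →+* ℂ) (H : Matrix (Fin 3) (Fin 3) L) (T : GL (Fin 3) ℂ)
      (hT : (T : Matrix (Fin 3) (Fin 3) ℂ)ᴴ * H.map ι * (T : Matrix (Fin 3) (Fin 3) ℂ) = Literature.Geometry.ComplexHyperbolic.BallModel.J)
      (νinf : @Measure (UnitaryGroup.arch (↥(maximalRealSubfield L)) L (IsCMField.complexConj L) 3 H) (borel _)),
      ArchCharactersLinIndep L ι H T hT νinf :=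
  fun L _ _ _ ι H T hT νinf => archCharactersLinIndep_of_letters hTC hGE hIR L ι H T hT νinf

end Summit.HodgeConjecture.HodgeConjecture.Cruxes.H413.F0T1aArchAssembly

end
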